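import Literature.Analysis.FunctionSpaces.MeasurableKernelGauge
import Mathlib.Analysis.InnerProductSpace.Dual
import Mathlib.MeasureTheory.Constructions.BorelSpace.Metrizable
import Mathlib.MeasureTheory.Function.StronglyMeasurable.AEStronglyMeasurable
import HarnessLib

/-!
# Measurable Gram operators of a countable measurable family of vectors

Analysis/FunctionSpaces support file (all results proved; no definitions, no named facts),
companion of `MeasurableKernelGauge` (the measurable gauge fixing modulo the kernels of a
measurable family of nonnegative symmetric operators). Given countably many measurable vector
fields `m n : ι → E` (`E` a finite-dimensional real inner product space), measurable "activity"
sets `S n ⊆ ι` and bounds `‖m n i‖ ≤ D n`, this file packages the weighted **Gram operator**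

  `A i = ∑ₙ aₙ 𝟙_{S n}(i) ⟪m n i, ·⟫ m n i`,   `aₙ = 2⁻ⁿ / max (D n) 1 ²`,

as an existence statement (`exists_measurable_gram_operator`): `A : ι → E →L[ℝ] E` is measurable,
each `A i` is symmetric and nonnegative, its kernel is exactly the joint annihilator of the active
vectors (`A i d = 0 → i ∈ S n → ⟪m n i, d⟫ = 0`), and for any (possibly non-measurable!) field
`c : ι → E` whose *activated pairings* `𝟙_{S n} ⟪c, m n⟫` are a.e. strongly measurable, so is
`i ↦ A i (c i)`. This is the device by which a non-measurable drift is replaced by a measurable one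
"modulo invisible directions" in the gauge bridge for the duality-form Liouville conjecture of
Koch–Nadirashvili–Seregin–Šverák (crux `TypeIliouvilleL`, item stmt-NavierStokesRegularity-10661):
the dynamics only sees the drift through countably many such pairings.

## References

* T. Kato, *Perturbation Theory for Linear Operators* (Springer 1995), I §5.3 (reduced resolvent;
  the companion file). [Kato1995]
* G. Koch, N. Nadirashvili, G. Seregin, V. Šverák, Acta Math. 203 (2009) = arXiv:0709.3599, §1
  p. 3 (the parasitic drift `b(t)`). [KochNadirashviliSereginSverak2009]
-/

noncomputable section

open MeasureTheory Set Function Filter Topology TopologicalSpace InnerProductSpace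
open scoped RealInnerProductSpace NNReal ENNReal

namespace Literature.Analysis.FunctionSpaces

variable {E : Type*} [NormedAddCommGroup E] [InnerProductSpace ℝ E] [FiniteDimensional ℝ E]

/-! ### Rank-one operators -/

section RankOne

omit [FiniteDimensional ℝ E] in
/-- The rank-one operator `x ↦ ⟪h, x⟫ h` depends continuously on `h`. [folklore] -/
theorem continuous_smulRight_innerSL :
    Continuous fun h : E => (innerSL ℝ h).smulRight h :=
  isBoundedBilinearMap_smulRight.continuous.comp ((innerSL ℝ).continuous.prodMk continuous_id)

omit [FiniteDimensional ℝ E] in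
/-- `‖⟪h, ·⟫ h‖ ≤ ‖h‖²`. [folklore] -/
theorem norm_smulRight_innerSL_le (h : E) : ‖(innerSL ℝ h).smulRight h‖ ≤ ‖h‖ * ‖h‖ := by
  rw [ContinuousLinearMap.norm_smulRight_apply, innerSL_apply_norm]

omit [FiniteDimensional ℝ E] in
/-- Unfolding the rank-one operator. [folklore] -/
theorem smulRight_innerSL_apply (h x : E) : (innerSL ℝ h).smulRight h x = ⟪h, x⟫ • h := by
  simp [ContinuousLinearMap.smulRight_apply]

end RankOne

/-! ### The Gram operator of a countable measurable family -/

section Gram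

variable {ι : Type*} [MeasurableSpace ι] [MeasurableSpace E] [BorelSpace E]

/-- **Measurable Gram operators.** Let `m n : ι → E` (`n : ℕ`) be measurable with `‖m n i‖ ≤ D n`,
and `S n ⊆ ι` measurable. There are positive weights `a n` and a measurable family of symmetric
nonnegative operators `A i` (`A i x = ∑ₙ aₙ 𝟙_{S n}(i) ⟪m n i, x⟫ m n i`, the series converging in
operator norm) such that: (kernel) `A i d = 0` forces `⟪m n i, d⟫ = 0` for every active `n`
(`i ∈ S n`); (measurability of activated images) for every field `c : ι → E` whose activated
pairings `i ↦ 𝟙_{S n}(i) ⟪c i, m n i⟫` are a.e. strongly measurable (`μ` any measure on `ι`), the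
field `i ↦ A i (c i)` is a.e. strongly measurable. [folklore] -/
theorem exists_measurable_gram_operator (μ : Measure ι)
    {m : ℕ → ι → E} (hm : ∀ n, Measurable (m n)) {D : ℕ → ℝ} (hD : ∀ n i, ‖m n i‖ ≤ D n)
    {S : ℕ → Set ι} (hS : ∀ n, MeasurableSet (S n)) :
    ∃ A : ι → E →L[ℝ] E, Measurable A ∧
      (∀ i, (A i : E →ₗ[ℝ] E).IsSymmetric) ∧ (∀ i x, 0 ≤ ⟪A i x, x⟫) ∧
      (∀ i d, A i d = 0 → ∀ n, i ∈ S n → ⟪m n i, d⟫ = 0) ∧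
      ∀ c : ι → E, (∀ n, AEStronglyMeasurable ((S n).indicator fun i => ⟪c i, m n i⟫) μ) →
        AEStronglyMeasurable (fun i => A i (c i)) μ := by
  classical
  -- weights
  set D' : ℕ → ℝ := fun n => max (D n) 1 with hD'
  have hD'1 : ∀ n, 1 ≤ D' n := fun n => le_max_right _ _
  have hD'0 : ∀ n, 0 < D' n := fun n => one_pos.trans_le (hD'1 n)
  have hmD' : ∀ n i, ‖m n i‖ ≤ D' n := fun n i => (hD n i).trans (le_max_left _ _)
  set a : ℕ → ℝ := fun n => (1 / 2 : ℝ) ^ n / (D' n) ^ 2 with ha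
  have ha0 : ∀ n, 0 < a n := fun n => by positivity
  -- indicator weights
  set w : ℕ → ι → ℝ := fun n i => a n * (S n).indicator (fun _ => (1 : ℝ)) i with hw
  have hw0 : ∀ n i, 0 ≤ w n i := fun n i =>
    mul_nonneg (ha0 n).le (indicator_nonneg (fun _ _ => zero_le_one) _)
  have hwa : ∀ n i, w n i ≤ a n := fun n i => by
    have : (S n).indicator (fun _ => (1 : ℝ)) i ≤ 1 :=
      indicator_le_self' (fun _ _ => zero_le_one) i
    calc w n i = a n * (S n).indicator (fun _ => (1 : ℝ)) i := rfl
      _ ≤ a n * 1 := mul_le_mul_of_nonneg_left this (ha0 n).le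
      _ = a n := mul_one _
  have hwm : ∀ n, Measurable (w n) := fun n =>
    measurable_const.mul (measurable_const.indicator (hS n))
  have hwS : ∀ n i, i ∈ S n → w n i = a n := fun n i hi => by
    simp only [hw, indicator_of_mem hi, mul_one]
  -- the terms and their summability
  set T : ℕ → ι → E →L[ℝ] E := fun n i => w n i • (innerSL ℝ (m n i)).smulRight (m n i) with hT
  have hTnorm : ∀ n i, ‖T n i‖ ≤ (1 / 2 : ℝ) ^ n := by
    intro n i
    calc ‖T n i‖ = |w n i| * ‖(innerSL ℝ (m n i)).smulRight (m n i)‖ := by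
          rw [hT]; exact norm_smul _ _
      _ ≤ a n * (D' n * D' n) := by
          rw [abs_of_nonneg (hw0 n i)]
          exact mul_le_mul (hwa n i) ((norm_smulRight_innerSL_le _).trans
            (mul_le_mul (hmD' n i) (hmD' n i) (norm_nonneg _) (hD'0 n).le)) (norm_nonneg _) (ha0 n).le
      _ = (1 / 2 : ℝ) ^ n := by
          rw [ha]
          field_simp [(hD'0 n).ne']
  have hgeom : Summable fun n : ℕ => (1 / 2 : ℝ) ^ n := summable_geometric_of_lt_one (by norm_num) (by norm_num)
  have hTsum : ∀ i, Summable fun n => T n i := fun i =>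
    Summable.of_norm_bounded hgeom (fun n => hTnorm n i)
  have hTmeas : ∀ n, Measurable (T n) := fun n =>
    (hwm n).smul ((continuous_smulRight_innerSL (E := E)).measurable.comp (hm n))
  -- the Gram operator
  set A : ι → E →L[ℝ] E := fun i => ∑' n, T n i with hA
  have hA_apply : ∀ i x, A i x = ∑' n, w n i • (⟪m n i, x⟫ • m n i) := by
    intro i x
    rw [hA]
    change (ContinuousLinearMap.apply ℝ E x) (∑' n, T n i) = _
    rw [ContinuousLinearMap.map_tsum _ (hTsum i)]
    refine tsum_congr fun n => ?_
    simp only [ContinuousLinearMap.apply_apply, hT, FunLike.coe_smul, Pi.smul_apply,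
      smulRight_innerSL_apply]
  have hsumx : ∀ i x, Summable fun n => w n i • (⟪m n i, x⟫ • m n i) := by
    intro i x
    have h := (ContinuousLinearMap.apply ℝ E x).summable (hTsum i)
    refine h.congr fun n => ?_
    simp only [ContinuousLinearMap.apply_apply, hT, FunLike.coe_smul, Pi.smul_apply,
      smulRight_innerSL_apply]
  have hA_inner : ∀ i x z, ⟪A i x, z⟫ = ∑' n, w n i * (⟪m n i, x⟫ * ⟪m n i, z⟫) := by
    intro i x z
    rw [hA_apply, real_inner_comm, ← innerSL_apply_apply ℝ (E := E),
      ContinuousLinearMap.map_tsum _ (hsumx i x)]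
    refine tsum_congr fun n => ?_
    simp only [innerSL_apply_apply, real_inner_smul_right]
    rw [real_inner_comm (m n i) z]
  have hsum_inner : ∀ i x z, Summable fun n => w n i * (⟪m n i, x⟫ * ⟪m n i, z⟫) := by
    intro i x z
    have h := (innerSL ℝ z).summable (hsumx i x)
    refine h.congr fun n => ?_
    simp only [innerSL_apply_apply, real_inner_smul_right]
    rw [real_inner_comm (m n i) z]
  refine ⟨A, ?_, ?_, ?_, ?_, ?_⟩
  · -- measurability: limit of the measurable partial sums
    refine measurable_of_tendsto_metrizable (f := fun N i => ∑ n ∈ Finset.range N, T n i)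
      (fun N => Finset.measurable_sum _ fun n _ => hTmeas n) ?_
    exact tendsto_pi_nhds.2 fun i => (hTsum i).hasSum.tendsto_sum_nat
  · -- symmetry
    intro i x z
    change ⟪A i x, z⟫ = ⟪x, A i z⟫
    have h2 : ⟪x, A i z⟫ = ⟪A i z, x⟫ := real_inner_comm _ _
    rw [hA_inner, h2, hA_inner]
    exact tsum_congr fun n => by ring
  · -- nonnegativity
    intro i x
    rw [hA_inner]
    exact tsum_nonneg fun n => mul_nonneg (hw0 n i) (mul_self_nonneg _)
  · -- kernel
    intro i d hd n hn
    have h0 : ∑' k, w k i * (⟪m k i, d⟫ * ⟪m k i, d⟫) = 0 := by rw [← hA_inner, hd, inner_zero_left]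
    have hnn : ∀ k, 0 ≤ w k i * (⟪m k i, d⟫ * ⟪m k i, d⟫) := fun k =>
      mul_nonneg (hw0 k i) (mul_self_nonneg _)
    have hall := (hasSum_zero_iff_of_nonneg hnn).1 (by rw [← h0]; exact (hsum_inner i d d).hasSum)
    have hterm : w n i * (⟪m n i, d⟫ * ⟪m n i, d⟫) = 0 := congr_fun hall n
    rw [hwS n i hn] at hterm
    rcases mul_eq_zero.1 hterm with h | h
    · exact absurd h (ha0 n).ne'
    · exact mul_self_eq_zero.1 h
  · -- measurability of activated images
    intro c hc
    have hterm : ∀ n, AEStronglyMeasurable (fun i => w n i • (⟪m n i, c i⟫ • m n i)) μ := by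
      intro n
      have heq : (fun i => w n i • (⟪m n i, c i⟫ • m n i)) =
          fun i => (a n * (S n).indicator (fun i => ⟪c i, m n i⟫) i) • m n i := by
        funext i
        by_cases hi : i ∈ S n
        · simp only [hw, indicator_of_mem hi, mul_one, smul_smul, real_inner_comm]
        · simp only [hw, indicator_of_notMem hi, mul_zero, zero_smul]
      rw [heq]
      exact (aestronglyMeasurable_const.mul (hc n)).smul (hm n).aestronglyMeasurable
    have hlim : ∀ i, Tendsto (fun N => ∑ n ∈ Finset.range N, w n i • (⟪m n i, c i⟫ • m n i)) atTop
        (𝓝 (A i (c i))) := fun i => by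
      rw [hA_apply]
      exact (hsumx i (c i)).hasSum.tendsto_sum_nat
    refine aestronglyMeasurable_of_tendsto_ae (f := fun N i => ∑ n ∈ Finset.range N, w n i • (⟪m n i, c i⟫ • m n i))
      atTop (fun N => ?_) (Eventually.of_forall hlim)
    exact Finset.aestronglyMeasurable_fun_sum _ fun n _ => hterm n

end Gram

end Literature.Analysis.FunctionSpaces
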